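import Summits.KontsevichZagierPeriods.KontsevichZagierPeriods.Theses.HurwitzMicroSectors
import Summits.KontsevichZagierPeriods.KontsevichZagierPeriods.Theorems.HurwitzMicroSectorsNormalFormPrinciplePiBoxTransfer
import Summits.KontsevichZagierPeriods.KontsevichZagierPeriods.Theorems.HurwitzMicroSectorsNormalFormPrincipleVariants2262

/-! TTRL-lite variant V2263 of stmt-KontsevichZagierPeriods-3869

Variant V2263 = `stub_boxRigidity` (the leaf `BoxRigidity` of `NormalFormPrinciple`: two representations
on open unit boxes with integrands of KZ's rational shape `p/q` over `ℚ` and equal values are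
KZ-equivalent) under the two-sided move `fix_nat:m=3; bound_nat:m'≤8` (left dimension frozen to `3`,
right dimension bounded by `8`). Verdict of the attempt seat: **open** — this file is the exact-strength
certificate, not a proof of the variant. A two-sided bound is exactly `BoxVanishing` of the LARGEST
dimension allowed (take `m' = 8` and compare with the zero representation on the `3`-box one way; pad
both sides to the `8`-box and subtract there the other way — the `3` and the bound are idle):
* `stub_boxRigidity_var2263_iff_boxVanishing_eight`: V2263 ⟺ **BoxVanishing 8** (every box-rational
  representation on `(0,1)⁸` of value `0` is a relation);
* `stub_boxRigidity_var2263_iff_var2262`: V2263 is literally the frozen sibling V2262 (`(m, m') = (3, 8)`,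
  file `…Variants2262`, itself ⟺ V2232), so bounding instead of freezing `m'` gains nothing;
* `stub_boxRigidity_var2263_iff_le_eight`: V2263 ⟺ BoxRigidity for ALL `m, m' ≤ 8` — Conjecture 1 of
  Kontsevich–Zagier for every pair of rational integrands on the boxes `(0,1)^{≤ 8}`;
* `boxVanishing_le_eight_of_stub_boxRigidity_var2263`: V2263 gives `BoxVanishing j` for every `j ≤ 8`,
  so it contains the square (`a + b·G = 0 ⇒ [a + b/(1+x²y²)]_{(0,1)²}` is a relation, `G` Catalan's
  constant) and dimension `5` (`ζ(5) = r ∈ ℚ ⇒ [1/(1 − x₁⋯x₅) − r]_{(0,1)⁵}` is a relation): statements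
  decided today by no theorem (irrationality open, no chain of moves known). This is the residual goal;
* `stub_boxRigidity_var2263_of_parent` / `_of_statement`: parent leaf ⇒ V2263 and
  `KontsevichZagierPeriods ⇒ V2263`, so a refutation of the variant would refute Conjecture 1 for the
  tree's calculus — the variant is neither provable nor refutable from the tree today.
(Contrast: both dimensions `≤ 1` is the theorem `boxRigidity_of_le_one`, by Baker.)
Source: M. Kontsevich, D. Zagier, *Periods* (2001), §1.2 Conjecture 1. Pure proof file, no definitions. -/

-- `Summit.<Summit>.<Problem>` is the tree's mandated summit-side namespace (CONVENTIONS §2); for this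
-- single-conjunct summit the two coincide, so the duplicate is deliberate.
set_option linter.dupNamespace false

noncomputable section

namespace Summit.KontsevichZagierPeriods.KontsevichZagierPeriods.Theorems

open MeasureTheory Set
open Literature.NumberTheory.Transcendental Literature.NumberTheory.Transcendental.KZ
open Summit.KontsevichZagierPeriods.KontsevichZagierPeriods.Theses.HurwitzMicroSectors
open Summit.KontsevichZagierPeriods.HurwitzMicroSectors.NormalFormPrinciple.PiBox

/-! ## The variant V2263 itself: exactly `BoxVanishing 8` -/

/-- **V2263 ⟺ `BoxVanishing 8`**: (⇒) the pair `(3, 8)` is allowed (`8 ≤ 8`), so compare a vanishing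
box-rational representation on `(0,1)⁸` with the zero representation on the `3`-box
(`boxVanishingDim_right_of_pair 3 8`); (⇐) pad both representations to the `8`-box and subtract there
(`boxRigidityLe_of_boxVanishingDim 8`, `3 ≤ 8`, `m' ≤ 8`). [cite: KontsevichZagier2001, §1.2 Conjecture 1] -/
theorem stub_boxRigidity_var2263_iff_boxVanishing_eight :
    (∀ (m' : ℕ) (N : IntegralRep 3) (N' : IntegralRep m'), m' ≤ 8 → N.domain = {x | ∀ i, x i ∈ Set.Ioo (0:ℝ) 1} → N.IsRational → N'.domain = {x | ∀ i, x i ∈ Set.Ioo (0:ℝ) 1} → N'.IsRational → N.value = N'.value → Equivalent N N') ↔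
    (∀ (M : IntegralRep 8), M.domain = {x | ∀ i, x i ∈ Set.Ioo (0:ℝ) 1} → M.IsRational →
      M.value = 0 → of M ∈ relations) :=
  ⟨fun h => boxVanishingDim_right_of_pair 3 8 fun N N' => h 8 N N' le_rfl,
    fun hvan m' N N' hm' => boxRigidityLe_of_boxVanishingDim 8 hvan 3 m' N N' (by norm_num) hm'⟩

/-- **V2263 ⟺ the frozen sibling V2262** (`fix_nat:m=3; fix_nat:m'=8`): both are `BoxVanishing 8`;
bounding the right dimension instead of freezing it gains nothing. [cite: KontsevichZagier2001, §1.2 Conjecture 1] -/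
theorem stub_boxRigidity_var2263_iff_var2262 :
    (∀ (m' : ℕ) (N : IntegralRep 3) (N' : IntegralRep m'), m' ≤ 8 → N.domain = {x | ∀ i, x i ∈ Set.Ioo (0:ℝ) 1} → N.IsRational → N'.domain = {x | ∀ i, x i ∈ Set.Ioo (0:ℝ) 1} → N'.IsRational → N.value = N'.value → Equivalent N N') ↔
    (∀ (N : IntegralRep 3) (N' : IntegralRep 8), N.domain = {x | ∀ i, x i ∈ Set.Ioo (0:ℝ) 1} → N.IsRational → N'.domain = {x | ∀ i, x i ∈ Set.Ioo (0:ℝ) 1} → N'.IsRational → N.value = N'.value → Equivalent N N') := by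
  rw [stub_boxRigidity_var2263_iff_boxVanishing_eight, stub_boxRigidity_var2262_iff_boxVanishing_eight]

/-- **V2263 ⟺ `BoxRigidity` for all `m, m' ≤ 8`** (the honest strength of the variant: Conjecture 1 for
all pairs of rational integrands on the open unit boxes of dimension at most `8`; so V2263 coincides with
every two-sided sibling of maximum dimension `8`). [cite: KontsevichZagier2001, §1.2 Conjecture 1] -/
theorem stub_boxRigidity_var2263_iff_le_eight :
    (∀ (m' : ℕ) (N : IntegralRep 3) (N' : IntegralRep m'), m' ≤ 8 → N.domain = {x | ∀ i, x i ∈ Set.Ioo (0:ℝ) 1} → N.IsRational → N'.domain = {x | ∀ i, x i ∈ Set.Ioo (0:ℝ) 1} → N'.IsRational → N.value = N'.value → Equivalent N N') ↔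
    (∀ (m m' : ℕ) (N : IntegralRep m) (N' : IntegralRep m'), m ≤ 8 → m' ≤ 8 →
      N.domain = {x | ∀ i, x i ∈ Set.Ioo (0:ℝ) 1} → N.IsRational →
      N'.domain = {x | ∀ i, x i ∈ Set.Ioo (0:ℝ) 1} → N'.IsRational →
      N.value = N'.value → Equivalent N N') := by
  rw [stub_boxRigidity_var2263_iff_var2262]
  exact stub_boxRigidity_var2262_iff_le_eight

/-- **V2263 ⇒ `BoxVanishing` in every dimension `j ≤ 8`** (monotonicity by padding): in particular the
square, which contains Catalan's dichotomy, and dimension `5`, which contains `ζ(5)`'s.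
[cite: KontsevichZagier2001, §1.2 Conjecture 1] -/
theorem boxVanishing_le_eight_of_stub_boxRigidity_var2263
    (h : ∀ (m' : ℕ) (N : IntegralRep 3) (N' : IntegralRep m'), m' ≤ 8 → N.domain = {x | ∀ i, x i ∈ Set.Ioo (0:ℝ) 1} → N.IsRational → N'.domain = {x | ∀ i, x i ∈ Set.Ioo (0:ℝ) 1} → N'.IsRational → N.value = N'.value → Equivalent N N')
    {j : ℕ} (hj : j ≤ 8) (N : IntegralRep j) (hNd : N.domain = {x | ∀ i, x i ∈ Set.Ioo (0:ℝ) 1})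
    (hNr : N.IsRational) (hv : N.value = 0) : of N ∈ relations :=
  boxVanishingDim_mono hj (stub_boxRigidity_var2263_iff_boxVanishing_eight.1 h) N hNd hNr hv

/-! ## V2263 follows from the parent leaf and from the Summit -/

/-- **The parent leaf ⇒ V2263** (specialisation `m := 3`, the bound on `m'` dropped; the converse is
not claimed — the parent is `BoxVanishing` in ALL dimensions). [cite: KontsevichZagier2001, §1.2 Conjecture 1] -/
theorem stub_boxRigidity_var2263_of_parent
    (h : ∀ (m m' : ℕ) (N : IntegralRep m) (N' : IntegralRep m'), N.domain = {x | ∀ i, x i ∈ Set.Ioo (0:ℝ) 1} → N.IsRational → N'.domain = {x | ∀ i, x i ∈ Set.Ioo (0:ℝ) 1} → N'.IsRational → N.value = N'.value → Equivalent N N') :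
    ∀ (m' : ℕ) (N : IntegralRep 3) (N' : IntegralRep m'), m' ≤ 8 → N.domain = {x | ∀ i, x i ∈ Set.Ioo (0:ℝ) 1} → N.IsRational → N'.domain = {x | ∀ i, x i ∈ Set.Ioo (0:ℝ) 1} → N'.IsRational → N.value = N'.value → Equivalent N N' :=
  fun m' N N' _ => h 3 m' N N'

/-- **`KontsevichZagierPeriods ⇒ V2263`**: the variant is a special case of Conjecture 1 for the tree's
calculus (`leaves_of_statement`) — so a refutation of the variant would refute the Summit.
[cite: KontsevichZagier2001, §1.2 Conjecture 1] -/
theorem stub_boxRigidity_var2263_of_statement (h : _root_.KontsevichZagierPeriods) :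
    ∀ (m' : ℕ) (N : IntegralRep 3) (N' : IntegralRep m'), m' ≤ 8 → N.domain = {x | ∀ i, x i ∈ Set.Ioo (0:ℝ) 1} → N.IsRational → N'.domain = {x | ∀ i, x i ∈ Set.Ioo (0:ℝ) 1} → N'.IsRational → N.value = N'.value → Equivalent N N' :=
  stub_boxRigidity_var2263_of_parent (leaves_of_statement h).1

end Summit.KontsevichZagierPeriods.KontsevichZagierPeriods.Theorems

end
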